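import Summits.QuantumFields.QCD.Theses.SpectralDefectExtinction

/-!
# `ChiralDescent` (crux stmt-QuantumFields-17527, route SpectralDefectExtinction) — negative-side
# support: the flavour guard `N_f = 2 ∨ N_f = 3` is load-bearing; `QCDOf 0` is false

Refuter crux-attack, 2026-08-16. Since the statement re-type p117723 (`QCDOf` gained the conjunct
`reg.IsChiralAtZero`), the flavourless instance of the summit family is REFUTABLE outright:
`Fin 0 → ℝ` is a singleton, so the body of `QCDOf 0` gaps the (pure-gauge) lattice theory of the
witness regularisation at some rate `Δ > 0`, while `IsChiralAtZero` denies it every uniform lattice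
gap — `not_qcdOf_zero`. (This supersedes the pre-re-type reading of `QCDOf 0` as "an open
pure-`SU(3)` statement".) Consequently the crux
`ChiralDescent : ∀ N_f, (N_f = 2 ∨ N_f = 3) → Threshold N_f → QCDOf N_f` cannot be freed of its
guard: extended to all `N_f` it would deny, at `N_f = 0`, threshold pure-gauge theory along an
asymptotically scaling, mass-scaling Wilson regularisation — the Wilson form of `SU(3)` Yang–Mills
existence with a mass gap, which is neither refutable nor constructible here
(`chiralDescent_false_without_guard_of`). Any proof of the crux must use `N_f ≥ 2` (physically:
two or more light flavours are what supply Goldstone pions / anomaly-matching gaplessness at the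
chiral point; for `N_f ≤ 1` the clause `IsChiralAtZero` is not expected to hold).
Also recorded: the lattice gap clause is monotone in the rate (and blind to the species
renormalisations — definitional, cf. the landed
`RobustYangMillsHandover.Negative.hasLatticeMassGap_species_irrel`, used here silently up to
definitional unfolding), so chirality and the per-mass body of `QCDOf` are jointly CONSISTENT for
`N_f ≥ 1` — together they force gaps `Δ(m_ε) < ε` at positive masses (`gap_lt_of_isChiralAtZero`),
as `m_π² ∝ m_q` predicts — no contradiction of the `N_f = 0` kind arises inside the guard.
-/

namespace Summit.QuantumFields.QCD.Theorems.ChiralDescent.Negative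

open Filter
open Literature.MathematicalPhysics.QuantumFieldTheory

variable {Nf : ℕ}

/-- The uniform lattice mass gap is monotone in the rate: a gap `Δ` is a gap `Δ' ≤ Δ`. [folklore] -/
theorem hasLatticeMassGap_mono (sch : QCDScheme Nf) {Δ Δ' : ℝ} (hle : Δ' ≤ Δ)
    (h : sch.HasLatticeMassGap Δ) : sch.HasLatticeMassGap Δ' := by
  intro R R' A B
  obtain ⟨C, hC⟩ := h R R' A B
  refine ⟨max C 0, ?_⟩
  filter_upwards [hC] with k hk S hS n hn
  refine (hk S hS n hn).trans ?_
  have ha : 0 ≤ sch.a k * n := mul_nonneg (sch.a_pos k).le (Nat.cast_nonneg n)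
  calc C * Real.exp (-(Δ * (sch.a k * n)))
      ≤ max C 0 * Real.exp (-(Δ * (sch.a k * n))) :=
        mul_le_mul_of_nonneg_right (le_max_left _ _) (Real.exp_pos _).le
    _ ≤ max C 0 * Real.exp (-(Δ' * (sch.a k * n))) :=
        mul_le_mul_of_nonneg_left (Real.exp_le_exp.mpr (by nlinarith)) (le_max_right _ _)

/-- **Chirality at zero and the per-mass gap clause are jointly consistent** and force arbitrarily
small positive gaps at positive masses: if `reg` is chiral at zero and every positive tuple has
some uniform lattice gap, then for every `ε > 0` some positive tuple has a gap `Δ ∈ (0, ε)`.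
[folklore] -/
theorem gap_lt_of_isChiralAtZero (reg : QCDRegularisation Nf) (hχ : reg.IsChiralAtZero)
    (hbody : ∀ m : Fin Nf → ℝ, (∀ f, 0 < m f) →
      ∃ (z shift : QCDField Nf → ℕ → ℝ), ∃ Δ > 0, (reg.scheme m z shift).HasLatticeMassGap Δ) :
    ∀ ε > (0 : ℝ), ∃ m : Fin Nf → ℝ, (∀ f, 0 < m f) ∧ ∃ Δ : ℝ, 0 < Δ ∧ Δ < ε ∧
      (reg.scheme m 0 0).HasLatticeMassGap Δ := by
  intro ε hε
  obtain ⟨m, hm, hno⟩ := hχ ε hε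
  obtain ⟨z, shift, Δ, hΔ, hgap⟩ := hbody m hm
  exact ⟨m, hm, Δ, hΔ, lt_of_not_ge fun hle => hno (hasLatticeMassGap_mono _ hle hgap), hgap⟩

/-- **`QCDOf 0` is false.** With no flavour there is exactly one mass tuple; the body of `QCDOf 0`
gives the witness's (pure-gauge) lattice theory a uniform gap `Δ > 0` and `IsChiralAtZero` denies
the gap `Δ` at the same (unique) tuple. Pure gauge theory is "not chiral at zero"; harmless for the
summit since `QCD := QCDOf 2 ∧ QCDOf 3`. [folklore] -/
theorem not_qcdOf_zero : ¬ QCDOf 0 := by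
  rintro ⟨reg, -, hχ, hbody⟩
  obtain ⟨z, shift, T, -, -, -, -, Δ, hΔ, -, hgap⟩ := hbody (fun i => i.elim0) (fun f => f.elim0)
  obtain ⟨m, -, hno⟩ := hχ Δ hΔ
  obtain rfl : m = fun i => i.elim0 := funext fun i => i.elim0
  exact hno hgap

/-- **The flavour guard of `ChiralDescent` is load-bearing** ("false without the guard", modulo
threshold pure-gauge theory): if `SU(3)` lattice gauge theory WITHOUT quarks has, along some
mass-scaling regularisation and above some threshold, the body of the crux's antecedent (OS limit
with `IsQCDAlong`, non-trivial non-Gaussian glue, one rate `Δ > 0` for `T.HasMassGap` and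
`HasLatticeMassGap`), then the UNGUARDED descent `∀ N_f, Threshold N_f → QCDOf N_f` is false — at
`N_f = 0`, by `not_qcdOf_zero`. The filed crux carries the guard `N_f = 2 ∨ N_f = 3`. [folklore] -/
theorem chiralDescent_false_without_guard_of
    (h0 : ∃ reg : QCDRegularisation 0, reg.HasMassScaling ∧ ∃ M₁ : ℝ, 0 ≤ M₁ ∧
      ∀ m : Fin 0 → ℝ, (∀ f, M₁ < m f) → ∃ (z shift : QCDField 0 → ℕ → ℝ) (T : OSData (QCDField 0) 4),
        IsQCDAlong (reg.scheme m z shift) T ∧ T.IsNontrivial QCDField.glue ∧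
          T.IsNonGaussian QCDField.glue ∧
            (∀ f g : Fin 0, f ≠ g → T.IsNontrivial (QCDField.pseudoRe f g)) ∧
              ∃ Δ > 0, T.HasMassGap Δ ∧ (reg.scheme m z shift).HasLatticeMassGap Δ) :
    ¬ (∀ Nf : ℕ, (∃ reg : QCDRegularisation Nf, reg.HasMassScaling ∧ ∃ M₁ : ℝ, 0 ≤ M₁ ∧
      ∀ m : Fin Nf → ℝ, (∀ f, M₁ < m f) → ∃ (z shift : QCDField Nf → ℕ → ℝ) (T : OSData (QCDField Nf) 4),
        IsQCDAlong (reg.scheme m z shift) T ∧ T.IsNontrivial QCDField.glue ∧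
          T.IsNonGaussian QCDField.glue ∧
            (∀ f g : Fin Nf, f ≠ g → T.IsNontrivial (QCDField.pseudoRe f g)) ∧
              ∃ Δ > 0, T.HasMassGap Δ ∧ (reg.scheme m z shift).HasLatticeMassGap Δ) → QCDOf Nf) :=
  fun h => not_qcdOf_zero (h 0 h0)

end Summit.QuantumFields.QCD.Theorems.ChiralDescent.Negative
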